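import Summits.MatrixMultiplication.OmegaCensus.SmallFormats.InvertiblePointDeltaLawThree
import Summits.MatrixMultiplication.OmegaCensus.SmallFormats.InvertiblePointDeltaLawPrep
import Summits.MatrixMultiplication.OmegaCensus.SmallFormats.MatMul225GF3CensusReduction
import Mathlib.FieldTheory.IsAlgClosed.AlgebraicClosure
import HarnessLib

/-!
# ω-census family (a): the δ-LAW, final form — over ANY field, a saturated invertible point forces `2r ≥ 7n`

Cell `pub-omega` (unit `pub-omega-tensor`, gen 34), topic `Summits/MatrixMultiplication/OmegaCensus` (sub-folder
`SmallFormats`). Framing (verbatim): lottery ticket; floor = certified bounds/negative ranges. HONEST FRAMING: the third form of the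
δ-law (`seven_mul_le_or_of_saturated_one`, which needs `P + 1` points of `P¹(k)`) made unconditional by BASE CHANGE to the algebraic
closure (infinitely many points): **Theorem (`seven_mul_le_two_mul_of_saturated`).** Over any field `k`, if an `r`-term bilinear
computation of `⟨2,2,n⟩` has an invertible `X₀` at which exactly `2n` of the X-forms are nonzero (the invertible line cap `r − 2n`
attained — a SATURATED point), then `7n ≤ 2r`. Equivalently (`two_mul_add_one_le_card_filter_ne_of_lt`): when `2r < 7n`, at every
invertible point at least `2n + 1` X-forms are nonzero. Saturated points DO occur at `2r ≥ 7n` (Strassen's `⟨2,2,2⟩@7`, its direct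
sums `⟨2,2,2m⟩@7m`, the `⟨2,2,4⟩@14` scheme), so the threshold is the Hopcroft–Kerr count. Ingredients: `BilinComp.baseChange22n`
(extension of scalars of a computation of `⟨2,2,n⟩` along a ring hom of fields, entrywise), the δ-law third form, and
`AlgebraicClosure k` (infinite). For the `𝔽₃` census: no scheme at any rung `(n, r)` with `r < 3.5n` — in particular `(5,17)`,
`(6,20)`, `(7,23)`, `(7,24)`, `(8,27)`, `(9,30)`, `(9,31)`, `(10,34)`, `(11,37)`, `(11,38)` — has a saturated invertible point.
Nothing here is a bound on `ω`.
-/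

namespace Summit.MatrixMultiplication.OmegaCensus.SmallFormats

open Module Matrix Literature.Computability.AlgebraicComplexity
open Summit.MatrixMultiplication.OmegaCensus.RankOnePlaneCapGeneral

namespace DeltaLaw

variable {k : Type*} [Field k] {L : Type*} [Field L] {n : ℕ} {ι : Type*} [Fintype ι] [DecidableEq ι]

/-! ## Base change of a computation of `⟨2,2,n⟩` along a field hom -/

/-- The scalar extension of a `k`-linear form on `k^{a×b}` to an `L`-linear form on `L^{a×b}` (entrywise through `φ`). -/
def dualMap {a b : ℕ} (φ : k →+* L) (f : Module.Dual k (Matrix (Fin a) (Fin b) k)) :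
    Module.Dual L (Matrix (Fin a) (Fin b) L) where
  toFun X := ∑ p : Fin a, ∑ q : Fin b, φ (f (single p q 1)) * X p q
  map_add' X Y := by
    simp only [Matrix.add_apply, mul_add, Finset.sum_add_distrib]
  map_smul' c X := by
    simp only [Matrix.smul_apply, smul_eq_mul, RingHom.id_apply, Finset.mul_sum]
    refine Finset.sum_congr rfl fun p _ => Finset.sum_congr rfl fun q _ => ?_
    ring

/-- On matrices coming from `k`, `dualMap φ f` is `φ ∘ f`. -/
theorem dualMap_map {a b : ℕ} (φ : k →+* L) (f : Module.Dual k (Matrix (Fin a) (Fin b) k))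
    (X : Matrix (Fin a) (Fin b) k) : dualMap φ f (X.map φ) = φ (f X) := by
  conv_rhs => rw [matrix_eq_sum_single X]
  simp only [dualMap, LinearMap.coe_mk, AddHom.coe_mk, Matrix.map_apply, map_sum]
  refine Finset.sum_congr rfl fun p _ => Finset.sum_congr rfl fun q _ => ?_
  rw [show single p q (X p q) = X p q • single p q (1 : k) by rw [smul_single, smul_eq_mul, mul_one], map_smul,
    smul_eq_mul, φ.map_mul, mul_comm]

/-- **Base change of a computation of `⟨2,2,n⟩`** along a hom of fields `φ : k → L`: forms extended entrywise, outputs mapped. -/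
def baseChange22n (φ : k →+* L) (β : BilinComp (mulBilin k 2 2 n) ι) : BilinComp (mulBilin L 2 2 n) ι where
  f i := dualMap φ (β.f i)
  g i := dualMap φ (β.g i)
  w i := (β.w i).map φ
  map_eq_sum X Y := by
    -- entrywise: expand both sides over the entries of `X` and `Y`
    ext u v
    rw [mulBilin_apply, Matrix.mul_apply, Matrix.sum_apply]
    simp only [Matrix.smul_apply, Matrix.map_apply, smul_eq_mul, dualMap, LinearMap.coe_mk, AddHom.coe_mk]
    -- the `k`-identity at `(E_ab, E_pq)`, entry `(u,v)`, mapped by `φ`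
    have key : ∀ (a b p : Fin 2) (q : Fin n),
        ∑ i, φ (β.f i (single a b 1)) * φ (β.g i (single p q 1)) * φ (β.w i u v) =
          (if b = p then (1 : L) else 0) * ((if u = a then 1 else 0) * (if v = q then 1 else 0)) := by
      intro a b p q
      have h := β.map_eq_sum (single a b (1 : k)) (single p q (1 : k))
      rw [mulBilin_apply] at h
      have huv := congr_fun (congr_fun h u) v
      rw [Matrix.sum_apply] at huv
      simp only [Matrix.smul_apply, smul_eq_mul] at huv
      have hE : φ ((single a b (1 : k) * single p q (1 : k)) u v) =
          (if b = p then (1 : L) else 0) * ((if u = a then 1 else 0) * (if v = q then 1 else 0)) := by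
        by_cases hbp : b = p
        · subst hbp
          rw [single_mul_single_same, mul_one, single_apply, if_pos rfl, one_mul]
          by_cases hua : u = a
          · subst hua
            by_cases hvq : v = q
            · subst hvq; simp
            · rw [if_neg (fun h' => hvq h'.2.symm), map_zero, if_pos rfl, if_neg hvq, mul_zero]
          · rw [if_neg (fun h' => hua h'.1.symm), map_zero, if_neg hua, zero_mul]
        · rw [single_mul_single_of_ne (h := hbp), Matrix.zero_apply, map_zero, if_neg hbp, zero_mul]
      rw [← hE, huv, map_sum]
      refine Finset.sum_congr rfl fun i _ => ?_
      rw [φ.map_mul, φ.map_mul]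
    -- expand the right-hand side term by term
    have step1 : ∀ i, (∑ a, ∑ b, φ (β.f i (single a b 1)) * X a b) * (∑ p, ∑ q, φ (β.g i (single p q 1)) * Y p q) *
        φ (β.w i u v) = ∑ a, ∑ b, ∑ p, ∑ q,
          X a b * Y p q * (φ (β.f i (single a b 1)) * φ (β.g i (single p q 1)) * φ (β.w i u v)) := by
      intro i
      rw [Finset.sum_mul, Finset.sum_mul]
      refine Finset.sum_congr rfl fun a _ => ?_
      rw [Finset.sum_mul, Finset.sum_mul]
      refine Finset.sum_congr rfl fun b _ => ?_
      rw [Finset.mul_sum, Finset.sum_mul]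
      refine Finset.sum_congr rfl fun p _ => ?_
      rw [Finset.mul_sum, Finset.sum_mul]
      refine Finset.sum_congr rfl fun q _ => ?_
      ring
    simp_rw [step1]
    -- bring the sum over `i` inside
    rw [Finset.sum_comm]
    have step2 : ∀ a : Fin 2, ∑ i, ∑ b, ∑ p, ∑ q,
        X a b * Y p q * (φ (β.f i (single a b 1)) * φ (β.g i (single p q 1)) * φ (β.w i u v)) =
        ∑ b, ∑ p, ∑ q, X a b * Y p q *
          ((if b = p then (1 : L) else 0) * ((if u = a then 1 else 0) * (if v = q then 1 else 0))) := by
      intro a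
      rw [Finset.sum_comm]; refine Finset.sum_congr rfl fun b _ => ?_
      rw [Finset.sum_comm]; refine Finset.sum_congr rfl fun p _ => ?_
      rw [Finset.sum_comm]; refine Finset.sum_congr rfl fun q _ => ?_
      rw [← Finset.mul_sum, key]
    simp_rw [step2]
    -- collapse the indicator sums: `a = u`, `p = b`, `q = v`
    symm
    rw [Finset.sum_eq_single_of_mem u (Finset.mem_univ u)]
    · refine Finset.sum_congr rfl fun b _ => ?_
      rw [Finset.sum_eq_single_of_mem b (Finset.mem_univ b)]
      · rw [Finset.sum_eq_single_of_mem v (Finset.mem_univ v)]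
        · simp
        · intro q _ hq; rw [if_neg (Ne.symm hq)]; ring
      · intro p' _ hp; refine Finset.sum_eq_zero fun q _ => ?_; rw [if_neg (Ne.symm hp)]; ring
    · intro a _ ha
      refine Finset.sum_eq_zero fun b _ => Finset.sum_eq_zero fun p' _ => Finset.sum_eq_zero fun q _ => ?_
      rw [if_neg (Ne.symm ha)]; ring

omit [DecidableEq ι] in
/-- The base-changed X-forms restrict to the original ones through `φ`. -/
theorem baseChange22n_f_map (φ : k →+* L) (β : BilinComp (mulBilin k 2 2 n) ι) (i : ι)
    (X : Matrix (Fin 2) (Fin 2) k) : (baseChange22n φ β).f i (X.map φ) = φ (β.f i X) :=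
  dualMap_map φ (β.f i) X


omit [DecidableEq ι] in
/-- The map of an invertible matrix is invertible. -/
theorem isUnit_det_map (φ : k →+* L) {X : Matrix (Fin 2) (Fin 2) k} (hX : IsUnit X.det) : IsUnit (X.map φ).det := by
  have h : φ X.det = (X.map φ).det := by rw [RingHom.map_det, RingHom.mapMatrix_apply]
  rw [← h]
  exact hX.map φ

omit [DecidableEq ι] in
/-- Base change does not change which X-forms vanish at a `k`-point. -/
theorem card_filter_baseChange [DecidableEq k] [DecidableEq L] (φ : k →+* L) (β : BilinComp (mulBilin k 2 2 n) ι)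
    (X : Matrix (Fin 2) (Fin 2) k) :
    (Finset.univ.filter fun i => (baseChange22n φ β).f i (X.map φ) ≠ 0).card =
      (Finset.univ.filter fun i => β.f i X ≠ 0).card := by
  congr 1
  ext i
  simp only [Finset.mem_filter, Finset.mem_univ, true_and, baseChange22n_f_map, map_ne_zero_iff φ φ.injective]

omit [Fintype ι] [DecidableEq ι] in
/-- Distinct scalars `a_i` give pairwise independent vectors `(1, a_i)`. -/
theorem pairwise_indep_of_injective {P : ℕ} (a : Fin (P + 1) → L) (ha : Function.Injective a) :
    ∀ i j : Fin (P + 1), i ≠ j →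
      (![1, a i] : Fin 2 → L) 0 * (![1, a j] : Fin 2 → L) 1 - (![1, a i] : Fin 2 → L) 1 * (![1, a j] : Fin 2 → L) 0 ≠ 0 := by
  intro i j hij
  simp only [Matrix.cons_val_zero, Matrix.cons_val_one, one_mul, mul_one]
  exact sub_ne_zero.mpr fun h => hij (ha h.symm)

section Final

variable [DecidableEq k]

/-- **THE δ-LAW, FINAL FORM (any field).** If an `r`-term bilinear computation of `⟨2,2,n⟩` has an invertible `X₀` at which exactly
`2n` of the X-forms are nonzero (a SATURATED invertible point: the line cap `r − 2n` attained), then `7n ≤ 2r`. The threshold is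
the Hopcroft–Kerr count: Strassen's `⟨2,2,2⟩@7`, the direct sums `⟨2,2,2m⟩@7m` and the `⟨2,2,4⟩@14` scheme have saturated points.
Proof: base change to the algebraic closure (infinitely many points of `P¹`), move `X₀` to `1`, third form of the law with
`P = r` points. -/
theorem seven_mul_le_two_mul_of_saturated (β : BilinComp (mulBilin k 2 2 n) ι) (X₀ : Matrix (Fin 2) (Fin 2) k)
    (hX₀ : IsUnit X₀.det) (hsat : (Finset.univ.filter fun i => β.f i X₀ ≠ 0).card = 2 * n) :
    7 * n ≤ 2 * Fintype.card ι := by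
  classical
  let L := AlgebraicClosure k
  let φ : k →+* L := algebraMap k L
  let β₁ := baseChange22n φ β
  have hX₁ : IsUnit (X₀.map φ).det := isUnit_det_map φ hX₀
  have hsat₁ : (Finset.univ.filter fun i => β₁.f i (X₀.map φ) ≠ 0).card = 2 * n := by
    rw [show (Finset.univ.filter fun i => β₁.f i (X₀.map φ) ≠ 0).card =
      (Finset.univ.filter fun i => β.f i X₀ ≠ 0).card by convert card_filter_baseChange φ β X₀]
    exact hsat
  -- move `X₀` to `1`
  obtain ⟨β₂, hf, -, -⟩ := exists_XsideTransform β₁ (X₀.map φ) (X₀.map φ)⁻¹ 1 1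
    (Matrix.mul_nonsing_inv _ hX₁) (Matrix.one_mul 1)
  have hf1 : ∀ i, β₂.f i 1 = β₁.f i (X₀.map φ) := fun i => by rw [hf, Matrix.mul_one, Matrix.mul_one]
  set O := Finset.univ.filter fun i => β₁.f i (X₀.map φ) ≠ 0 with hOdef
  have hO : ∀ i, i ∉ O → β₂.f i 1 = 0 := fun i hi => by
    rw [hf1]; by_contra h; exact hi (Finset.mem_filter.mpr ⟨Finset.mem_univ i, h⟩)
  have hO' : ∀ i ∈ O, β₂.f i 1 ≠ 0 := fun i hi => by rw [hf1]; exact (Finset.mem_filter.mp hi).2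
  -- `card ι + 1` distinct scalars in the (infinite) algebraic closure
  let emb := Infinite.natEmbedding L
  let a : Fin (Fintype.card ι + 1) → L := fun i => emb i
  have ha : Function.Injective a := fun i j h => Fin.ext (emb.injective h)
  exact seven_mul_le_two_mul_of_saturated_one (Fintype.card ι) (fun i => ![1, a i]) (pairwise_indep_of_injective a ha)
    (by omega) β₂ O hO hO' hsat₁

/-- **Census form, final (any field):** if `2r < 7n`, NO invertible point of an `r`-term computation of `⟨2,2,n⟩` is saturated —
at every invertible `X₀` at least `2n + 1` X-forms are nonzero (at most `r − 2n − 1` vanish). -/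
theorem two_mul_add_one_le_card_filter_ne_of_lt (β : BilinComp (mulBilin k 2 2 n) ι) (h7 : 2 * Fintype.card ι < 7 * n)
    (X₀ : Matrix (Fin 2) (Fin 2) k) (hX₀ : IsUnit X₀.det) :
    2 * n + 1 ≤ (Finset.univ.filter fun i => β.f i X₀ ≠ 0).card := by
  have h1 : 2 * n ≤ (Finset.univ.filter fun i => β.f i X₀ ≠ 0).card := by
    convert two_mul_le_card_filter_ne β X₀ hX₀
  rcases Nat.lt_or_ge (2 * n) (Finset.univ.filter fun i => β.f i X₀ ≠ 0).card with h | h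
  · exact h
  · have heq : (Finset.univ.filter fun i => β.f i X₀ ≠ 0).card = 2 * n := le_antisymm h h1
    have := seven_mul_le_two_mul_of_saturated β X₀ hX₀ heq
    omega

/-- **31-term `⟨2,2,9⟩` (any field): no saturated invertible point** (`62 < 63`): at least 19 of the 31 X-forms are nonzero at
every invertible point. (Not reachable by the third form over `𝔽₃` alone.) -/
theorem nineteen_le_card_filter_ne_229_31 (β : BilinComp (mulBilin k 2 2 9) ι) (hι : Fintype.card ι = 31)
    (X₀ : Matrix (Fin 2) (Fin 2) k) (hX₀ : IsUnit X₀.det) : 19 ≤ (Finset.univ.filter fun i => β.f i X₀ ≠ 0).card :=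
  two_mul_add_one_le_card_filter_ne_of_lt β (by rw [hι]; norm_num) X₀ hX₀

/-- **38-term `⟨2,2,11⟩` (any field): no saturated invertible point** (`76 < 77`). -/
theorem twentythree_le_card_filter_ne_2211_38 (β : BilinComp (mulBilin k 2 2 11) ι) (hι : Fintype.card ι = 38)
    (X₀ : Matrix (Fin 2) (Fin 2) k) (hX₀ : IsUnit X₀.det) : 23 ≤ (Finset.univ.filter fun i => β.f i X₀ ≠ 0).card :=
  two_mul_add_one_le_card_filter_ne_of_lt β (by rw [hι]; norm_num) X₀ hX₀

end Final

end DeltaLaw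

end Summit.MatrixMultiplication.OmegaCensus.SmallFormats
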